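import Summits.QuantumFields.YangMills.Theorems.BalabanUVNodesN16Eq42FirstMomentGauge
import Summits.QuantumFields.YangMills.Theorems.BalabanUVNodesN16Eq42PermutationDefectNonAbelian
import HarnessLib

/-!
# YM-DAG node N16 (NE3), the located averaging pin (42) ↔ (0.4) — part 9: THE COARSE-LATTICE AND NON-ABELIAN READINGS OF «THE CENTRING PART IS A GAUGE».
# Sampled on the `L`-lattice `q₀ + Lℤᵈ` the first-moment 1-form is a COARSE gradient `Λ(ζ+e_κ) − Λ(ζ)` up to `|ζ|₁·2Lδ·Σ_m|c_m|` (the flux moves by `≤ Lδ`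
# per coarse step); hence the corner-block (42) exponent minus the offset∕centred-block ((0.4)-type) exponent at the coarse bond `⟨x, x+Le_κ⟩`, `x = q₀ + Lζ`,
# is the coarse pure gauge `dΛ(ζ,κ)` + `O(L³δ)` — linearised (part 7 + part 8 §4 sampled) and NON-ABELIAN (`+ ρ₂(ℓ,a) + ρ₂(ℓ_s,a)`, part 3's second order)

Cell `pub-ymgap`, width seat `pub-ymgap-dag-n16-w3` (director-ym №197 ∕ HUMAN RULING D-0149), generation 5; part 9 of the W1b sequel (part 8
`…N16Eq42FirstMomentGauge`: the lattice Poincaré lemma + the fine-lattice reading).  `--kind proof --supports stmt-QuantumFields-20544 --as helper` (K3⁷;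
count-neutral; 0 def).  `bears_on: R4∕N16`.

THE POINT.  The block averages live on the COARSE bonds `⟨x, x + Le_κ⟩`, `x ∈ q₀ + Lℤᵈ`; a coarse gauge transformation multiplies an (abelian) coarse bond
variable by `e^{Λ(ζ+e_κ) − Λ(ζ)}`.  So the reading of «corner − centred = pure gauge» relevant to the averaged field is the COARSE one: the bond function
`x ↦ ω_c(x,κ) = Σ_m c_m • F_{mκ}(x)` restricted to the `L`-lattice must be a coarse gradient.  Part 8's §2–§4 are lattice-agnostic (any plane-indexed family
of site functions on ℤᵈ), so this is part 8 applied to the COARSE SAMPLES `F^L_ζ(m κ) := A(∂p)_{q₀ + L•ζ}(m κ)`: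
 * §1 `norm_flux_coarseStep_sub_le`: unit-step `δ`-Lipschitz flux moves by `≤ L·δ` under a coarse step `L•e_μ` (part 8 `norm_sub_le_of_unit_steps_tree`);
 * §2 ★ `coarseMoment_eq_axial_of_const_flux` (constant curvature: `ω_c` on the `L`-lattice IS the coarse gradient of its coarse tree potential
   `Λ(ζ) = asum Θ 0 (treeWord ζ)`, `Θ(z,κ) = ω_c(q₀ + L•z, κ)`); ★★ `norm_coarseMoment_sub_axial_le`: on unit-step `δ`-Lipschitz flux within radius
   `L(3|ζ|₁+2)` of `q₀`, `‖ω_c(q₀+L•ζ, κ) − (Λ(ζ+e_κ) − Λ(ζ))‖ ≤ |ζ|₁·2Lδ·Σ_m|c_m|`; `norm_coarseShiftMoment_sub_axial_le` (`c_m = L s_m`: `≤ |ζ|₁·2L²|s|₁δ`);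
 * §3 ★★ `norm_corner_sub_stencil_sub_coarseAxial_le` (with part 7): at `x = q₀ + L•ζ`,
   `‖(X̂ L A x κ − [offset-s exponent](x,κ)) − (Λ(ζ+e_κ) − Λ(ζ))‖ ≤ (2dL+|s|₁)·L·(2(dL+|s|₁)+L)·δ + |ζ|₁·2L²|s|₁δ` — the LINEARISED corner-block (42)
   exponent minus the offset-`s` (centred: `L = 2M+1`, `s = M·𝟙`) exponent IS the coarse pure gauge `dΛ` up to `O((d²L³ + dL²|s|₁ + L|s|₁² + |ζ|₁L²|s|₁)δ)`;
 * §4 NON-ABELIAN (any complete normed ℂ-algebra with `‖1‖ = 1`, `V_b = e^{A_b}`, `‖A_b‖ ≤ a` near `x`): `length_loop_offset_le` (the offset loops have length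
   `≤ ℓ_s := 2(dL+|s|₁) + 2L`); ★ `norm_XavgOffset_sub_linear_le` (the offset-stencil exponent `Σ_r L^{−d}•log[V(Γ_{c,x−s+r})V(c)⁻¹]` is within `ρ₂(ℓ_s,a)` of
   its linearisation — part 3's `norm_mlog_hol_sub_asum_le` termwise; `s = 0` is part 3's `norm_Xavg_sub_Xhat_le`); ★★ `norm_Xavg_sub_XavgOffset_sub_coarseAxial_le`:
   `‖(X_c − X^{(s)}_c) − dΛ(ζ,κ)‖ ≤ ρ₂(ℓ,a) + ρ₂(ℓ_s,a) + [§3]` — THE NON-ABELIAN CORNER EXPONENT OF (42) MINUS THE OFFSET∕CENTRED ONE IS A COARSE PURE GAUGE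
   UP TO SECOND ORDER IN `a` AND `O(L³δ)`.

READING FOR N16 (honest).  This closes the first-order anatomy of the located pin p584628 (`W3-PIN-ANATOMY.md`): (42) ↔ (0.4) = [axis permutations:
`O(d²L³δ) + 2ρ₂`, zero∕second order at constant curvature — parts 1–5] + [block centring ∕ reflections: a COARSE PURE GAUGE `dΛ` + `O(d²L³δ) + 2ρ₂` —
parts 6–9].  On a level-`j` field of [B11]-Thm-1 TYPE regularity both error brackets are one power of `η = L^{−j}` below the averages' own first-order size.
Nothing here is a statement about minimisers, about `Transfer42to04 ∕ Transfer04to42`, or about Bałaban's estimates.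

HONEST FRAMING.  [folklore] finite-sum bookkeeping BY NAME over part 8 (`norm_moment_sub_axial_le`, `moment_eq_axial_of_const`, `norm_sub_le_of_unit_steps_tree`),
part 7 (`norm_corner_sub_stencil_sub_le`), part 3 (`norm_mlog_hol_sub_asum_le`) and `B7Prop1Explicit` (`Wcx_eq_hol_loop`, `length_gammaWord`, `l1_zsmul_e`);
0 `def`, 0 `sorry`; no printed sentence is a hypothesis; nothing of [Balaban1985Averaging] ∕ [Balaban1987RG1] asserted beyond what the tree proves; no minimiser;
`stub_h7` ∕ the K3⁷ stubs NOT touched; N16 ∕ NE3 NOT discharged; count-neutral (typed 28∕28 · discharged 5∕27 work-bound, A 5∕28 — unmoved).  One finite four-torus programme at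
fixed `ε` — the Yang–Mills mass gap (Clay) is NOT proved by any of this; R4 closes the conditional finite-𝕋⁴ rung `BalabanLadder.UV` only; nothing continuum ∕ ℝ⁴ ∕ OS.
-/

set_option autoImplicit false

open scoped BigOperators
open NormedSpace Finset

namespace Summit.QuantumFields.YangMills.BalabanUVNodes.N16Eq42FirstMomentGaugeCoarse

open Literature.MathematicalPhysics.QuantumFieldTheory.Balaban1983to89
open B7Prop1Explicit
open Summit.QuantumFields.YangMills.BalabanUVNodes.N16Eq42FirstMomentGauge
  (norm_sub_le_of_unit_steps_tree norm_moment_sub_axial_le moment_eq_axial_of_const)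
open Summit.QuantumFields.YangMills.BalabanUVNodes.N16Eq42StencilLipschitz (norm_corner_sub_stencil_sub_le)
open Summit.QuantumFields.YangMills.BalabanUVNodes.N16Eq42PermutationDefectNonAbelian (norm_mlog_hol_sub_asum_le)

noncomputable section

variable {d : ℕ}
variable {𝔸 : Type*} [NormedRing 𝔸]

/-! ## §1 The flux under one coarse step -/

/-- **A COARSE STEP COSTS `L·δ`**: if the flux in the plane `(m, ν)` moves by `≤ δ` under every unit step at base points within `|·|₁`-distance `R` of `q₀`,
then `‖A(∂p)_{y + L•e_μ}(m ν) − A(∂p)_y(m ν)‖ ≤ L·δ` whenever `|y − q₀|₁ + L ≤ R` (part 8 `norm_sub_le_of_unit_steps_tree` along `seg μ L`). [folklore] -/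
theorem norm_flux_coarseStep_sub_le (L : ℕ) (A : Site d → Fin d → 𝔸) (q₀ : Site d) (R : ℕ) (m ν : Fin d) {δ : ℝ}
    (hLip : ∀ (y : Site d) (μ : Fin d), l1 (y - q₀) ≤ R → ‖asum A (y + e μ) (plaqWord m ν) - asum A y (plaqWord m ν)‖ ≤ δ)
    (y : Site d) (μ : Fin d) (hy : l1 (y - q₀) + L ≤ R) :
    ‖asum A (y + (L : ℤ) • e μ) (plaqWord m ν) - asum A y (plaqWord m ν)‖ ≤ L * δ := by
  have h := norm_sub_le_of_unit_steps_tree (fun z => asum A z (plaqWord m ν)) q₀ R (δ := δ) hLip y ((L : ℤ) • e μ)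
    (by rw [l1_zsmul_e, Int.natAbs_natCast]; exact hy)
  rw [l1_zsmul_e, Int.natAbs_natCast, mul_comm] at h
  exact h

/-- Coarse points and coarse steps in fine coordinates: `q₀ + L•(z + e_μ) = (q₀ + L•z) + L•e_μ`. [folklore] -/
theorem coarsePoint_add_e (L : ℕ) (q₀ z : Site d) (μ : Fin d) :
    q₀ + (L : ℤ) • (z + e μ) = q₀ + (L : ℤ) • z + (L : ℤ) • e μ := by
  rw [smul_add, add_assoc]

/-- `|q₀ + L•z − q₀|₁ = L·|z|₁`. [folklore] -/
theorem l1_coarsePoint (L : ℕ) (q₀ z : Site d) : l1 (q₀ + (L : ℤ) • z - q₀) = L * l1 z := by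
  rw [add_sub_cancel_left]
  unfold l1
  rw [Finset.mul_sum]
  refine Finset.sum_congr rfl fun ι _ => ?_
  rw [Pi.smul_apply, smul_eq_mul, Int.natAbs_mul, Int.natAbs_natCast]

section Coarse

variable [NormedAlgebra ℂ 𝔸]

/-! ## §2 The first-moment form sampled on the `L`-lattice is a coarse gradient -/

/-- **★ CONSTANT CURVATURE: on the `L`-lattice the moment form IS the coarse gradient of its coarse tree potential** `Λ(z) = asum Θ 0 (treeWord z)`,
`Θ(z,κ) = Σ_m c_m • A(∂p)_{q₀+L•z}(m κ)` (part 8 `moment_eq_axial_of_const` for the coarse samples). [folklore] -/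
theorem coarseMoment_eq_axial_of_const_flux (L : ℕ) (A : Site d → Fin d → 𝔸) (c : Fin d → ℝ) (q₀ : Site d) (f : Fin d → Fin d → 𝔸)
    (hf : ∀ (y : Site d) (m κ : Fin d), asum A y (plaqWord m κ) = f m κ) (ζ : Site d) (κ : Fin d) :
    (∑ m : Fin d, c m • asum A (q₀ + (L : ℤ) • ζ) (plaqWord m κ))
      = asum (fun z κ' => ∑ m : Fin d, c m • asum A (q₀ + (L : ℤ) • z) (plaqWord m κ')) 0 (treeWord (ζ + e κ))
        - asum (fun z κ' => ∑ m : Fin d, c m • asum A (q₀ + (L : ℤ) • z) (plaqWord m κ')) 0 (treeWord ζ) := by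
  have h := moment_eq_axial_of_const (fun z m κ' => asum A (q₀ + (L : ℤ) • z) (plaqWord m κ')) c f (fun y m κ' => hf _ m κ') 0 ζ κ
  simpa only [zero_add] using h

/-- **★★ LIPSCHITZ FLUX: ON THE `L`-LATTICE THE MOMENT FORM IS A COARSE GRADIENT UP TO `|ζ|₁·2Lδ·Σ|c|`.**  If the flux moves by `≤ δ` under every unit
step, in every plane, at base points within `|·|₁`-distance `L(3|ζ|₁ + 2)` of `q₀`, then
`‖Σ_m c_m • A(∂p)_{q₀+L•ζ}(m κ) − (Λ(ζ+e_κ) − Λ(ζ))‖ ≤ |ζ|₁ · 2Lδ · Σ_m|c_m|` (part 8 `norm_moment_sub_axial_le` for the coarse samples, §1 for their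
coarse steps). [folklore] -/
theorem norm_coarseMoment_sub_axial_le (L : ℕ) (A : Site d → Fin d → 𝔸) (c : Fin d → ℝ) (q₀ ζ : Site d) (κ : Fin d) {δ : ℝ}
    {R : ℕ} (hR : L * (3 * l1 ζ + 2) ≤ R)
    (hLip : ∀ (y : Site d) (m μ ν : Fin d), l1 (y - q₀) ≤ R → ‖asum A (y + e μ) (plaqWord m ν) - asum A y (plaqWord m ν)‖ ≤ δ) :
    ‖(∑ m : Fin d, c m • asum A (q₀ + (L : ℤ) • ζ) (plaqWord m κ))
        - (asum (fun z κ' => ∑ m : Fin d, c m • asum A (q₀ + (L : ℤ) • z) (plaqWord m κ')) 0 (treeWord (ζ + e κ))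
            - asum (fun z κ' => ∑ m : Fin d, c m • asum A (q₀ + (L : ℤ) • z) (plaqWord m κ')) 0 (treeWord ζ))‖
      ≤ l1 ζ * (2 * (L * δ) * ∑ m : Fin d, |c m|) := by
  have h := norm_moment_sub_axial_le (fun z m κ' => asum A (q₀ + (L : ℤ) • z) (plaqWord m κ')) c 0 ζ κ (δ := L * δ)
    (fun y m μ ν hy => by
      show ‖asum A (q₀ + (L : ℤ) • (y + e μ)) (plaqWord m ν) - asum A (q₀ + (L : ℤ) • y) (plaqWord m ν)‖ ≤ L * δ
      rw [coarsePoint_add_e]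
      refine norm_flux_coarseStep_sub_le L A q₀ R m ν (fun y' μ' hy' => hLip y' m μ' ν hy') _ μ ?_
      rw [l1_coarsePoint]
      rw [sub_zero] at hy
      nlinarith)
  simpa only [zero_add] using h

/-- **THE COARSE FIRST-MOMENT FORM OF THE STENCIL SHIFT `s` (`c_m = L s_m`)**: `‖Σ_m (L s_m) • A(∂p)_{q₀+L•ζ}(m κ) − dΛ(ζ,κ)‖ ≤ |ζ|₁ · 2L²|s|₁ · δ`.
[folklore] -/
theorem norm_coarseShiftMoment_sub_axial_le (L : ℕ) (A : Site d → Fin d → 𝔸) (s : Site d) (q₀ ζ : Site d) (κ : Fin d) {δ : ℝ}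
    {R : ℕ} (hR : L * (3 * l1 ζ + 2) ≤ R)
    (hLip : ∀ (y : Site d) (m μ ν : Fin d), l1 (y - q₀) ≤ R → ‖asum A (y + e μ) (plaqWord m ν) - asum A y (plaqWord m ν)‖ ≤ δ) :
    ‖(∑ m : Fin d, ((L : ℝ) * (s m : ℝ)) • asum A (q₀ + (L : ℤ) • ζ) (plaqWord m κ))
        - (asum (fun z κ' => ∑ m : Fin d, ((L : ℝ) * (s m : ℝ)) • asum A (q₀ + (L : ℤ) • z) (plaqWord m κ')) 0 (treeWord (ζ + e κ))
            - asum (fun z κ' => ∑ m : Fin d, ((L : ℝ) * (s m : ℝ)) • asum A (q₀ + (L : ℤ) • z) (plaqWord m κ')) 0 (treeWord ζ))‖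
      ≤ l1 ζ * (2 * (L * δ) * ((L : ℝ) * l1 s)) := by
  have h := norm_coarseMoment_sub_axial_le L A (fun m => (L : ℝ) * (s m : ℝ)) q₀ ζ κ (δ := δ) hR hLip
  have hsum : ∑ m : Fin d, |(L : ℝ) * (s m : ℝ)| = (L : ℝ) * l1 s := by
    unfold l1
    push_cast
    rw [Finset.mul_sum]
    refine Finset.sum_congr rfl fun m _ => ?_
    rw [abs_mul, Nat.abs_cast, Nat.cast_natAbs, Int.cast_abs]
  rwa [hsum] at h

/-! ## §3 With part 7: the linearised corner exponent minus the offset exponent is a coarse pure gauge up to `O(L³δ)` -/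

/-- **★★ THE CENTRING PART OF THE PIN IS A COARSE GAUGE + `O(L³δ)` (linearised level).**  Let the flux move by `≤ δ` under every unit step at base points
within `|·|₁`-distance `R` of `q₀`, `R ≥ L(3|ζ|₁+2)` and `R ≥ L|ζ|₁ + 2(dL+|s|₁) + L`.  At the coarse bond `⟨x, x+Le_κ⟩`, `x = q₀ + L•ζ`, the corner-block
exponent `X̂` ((42), linearised) minus the offset-`s` stencil exponent (centred block of (0.4): `L = 2M+1`, `s = M·𝟙`) equals the COARSE pure gauge
`Λ(ζ+e_κ) − Λ(ζ)` (`Λ` the coarse tree potential of `ζ ↦ Σ_m (L s_m)•A(∂p)_{q₀+L•ζ}(m ·)`) up to `(2dL+|s|₁)·L·((2(dL+|s|₁)+L)δ) + |ζ|₁·2L²|s|₁δ`. [folklore] -/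
theorem norm_corner_sub_stencil_sub_coarseAxial_le (L : ℕ) (hL : 1 ≤ L) (A : Site d → Fin d → 𝔸) (q₀ ζ : Site d) (κ : Fin d) (s : Site d)
    {δ : ℝ} (hδ : 0 ≤ δ) {R : ℕ} (hR : L * (3 * l1 ζ + 2) ≤ R) (hR' : L * l1 ζ + (2 * (d * L + l1 s) + L) ≤ R)
    (hLip : ∀ (y : Site d) (m μ ν : Fin d), l1 (y - q₀) ≤ R → ‖asum A (y + e μ) (plaqWord m ν) - asum A y (plaqWord m ν)‖ ≤ δ) :
    ‖(Xhat L A (q₀ + (L : ℤ) • ζ) κ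
          - ∑ r : Fin d → Fin L, (((L : ℝ) ^ d)⁻¹) • asum A (q₀ + (L : ℤ) • ζ) (gammaWord L κ (boxVec L r - s) ++ seg κ (-(L : ℤ))))
        - (asum (fun z κ' => ∑ m : Fin d, ((L : ℝ) * (s m : ℝ)) • asum A (q₀ + (L : ℤ) • z) (plaqWord m κ')) 0 (treeWord (ζ + e κ))
            - asum (fun z κ' => ∑ m : Fin d, ((L : ℝ) * (s m : ℝ)) • asum A (q₀ + (L : ℤ) • z) (plaqWord m κ')) 0 (treeWord ζ))‖
      ≤ (2 * (d * L) + l1 s) * L * ((2 * (d * L + l1 s) + L) * δ) + l1 ζ * (2 * (L * δ) * ((L : ℝ) * l1 s)) := by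
  set x : Site d := q₀ + (L : ℤ) • ζ with hx
  have hxq : l1 (x - q₀) = L * l1 ζ := l1_coarsePoint L q₀ ζ
  -- part 7 at the base point `x`, with `Δ := (2(dL+|s|₁)+L)·δ` supplied by the unit steps (part 8 `norm_sub_le_of_unit_steps_tree`)
  have hΔ : 0 ≤ (2 * (d * L + l1 s) + L : ℝ) * δ := by positivity
  have h7 := norm_corner_sub_stencil_sub_le L hL A x κ (fun m => asum A x (plaqWord m κ)) s hΔ
    (fun m y hy => by
      have h := norm_sub_le_of_unit_steps_tree (fun z => asum A z (plaqWord m κ)) q₀ R (δ := δ)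
        (fun z μ hz => hLip z m μ κ hz) x (y - x) (by omega)
      rw [show x + (y - x) = y by abel] at h
      refine h.trans ?_
      rw [mul_comm]
      exact mul_le_mul_of_nonneg_right (by exact_mod_cast hy) hδ)
  have h9 := norm_coarseShiftMoment_sub_axial_le L A s q₀ ζ κ (δ := δ) hR hLip
  calc _ = ‖((Xhat L A x κ - ∑ r : Fin d → Fin L, (((L : ℝ) ^ d)⁻¹) • asum A x (gammaWord L κ (boxVec L r - s) ++ seg κ (-(L : ℤ))))
            - ∑ m : Fin d, ((L : ℝ) * (s m : ℝ)) • asum A x (plaqWord m κ))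
          + ((∑ m : Fin d, ((L : ℝ) * (s m : ℝ)) • asum A x (plaqWord m κ))
            - (asum (fun z κ' => ∑ m : Fin d, ((L : ℝ) * (s m : ℝ)) • asum A (q₀ + (L : ℤ) • z) (plaqWord m κ')) 0 (treeWord (ζ + e κ))
              - asum (fun z κ' => ∑ m : Fin d, ((L : ℝ) * (s m : ℝ)) • asum A (q₀ + (L : ℤ) • z) (plaqWord m κ')) 0 (treeWord ζ)))‖ := by
          rw [sub_add_sub_cancel]
    _ ≤ _ := norm_add_le _ _
    _ ≤ _ := add_le_add h7 h9

end Coarse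

/-! ## §4 Non-abelian: the offset-stencil exponent against its linearisation; corner minus offset is a coarse gauge to second order -/

section NonAbelian

variable [NormOneClass 𝔸] [NormedAlgebra ℂ 𝔸] [CompleteSpace 𝔸]

omit [NormOneClass 𝔸] [NormedAlgebra ℂ 𝔸] [CompleteSpace 𝔸] in
/-- The loops of the offset-`s` stencil at a `κ`-bond have length `≤ ℓ_s := 2(dL + |s|₁) + 2L`. [folklore] -/
theorem length_loop_offset_le (L : ℕ) (κ : Fin d) (r : Fin d → Fin L) (s : Site d) :
    (gammaWord L κ (boxVec L r - s) ++ seg κ (-(L : ℤ))).length ≤ 2 * (d * L + l1 s) + L + L := by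
  rw [List.length_append, length_gammaWord, length_seg]
  have := Summit.QuantumFields.YangMills.BalabanUVNodes.N16Eq42StencilLipschitz.l1_boxVec_sub_le L r s
  simp only [Int.natAbs_neg, Int.natAbs_natCast]
  omega

omit [NormOneClass 𝔸] in
/-- **★ THE OFFSET-STENCIL EXPONENT AGAINST ITS LINEARISATION**: for `V_b = e^{A_b}`, `‖A_b‖ ≤ a` on the bonds within `|·|₁`-distance `ℓ_s = 2(dL+|s|₁) + 2L`
of `x`, with `e^{ℓ_s a} − 1 ≤ ½`, the non-abelian offset exponent `Σ_r L^{−d} • log[V(Γ_{c,x−s+r}) V(c)⁻¹]` (the displayed `mlog ∘ Wcx` block mean over the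
stencil `{x − s + r}`) is within `ρ₂(ℓ_s,a) = ρ(2(e^{ℓ_s a} − 1)) + ρ(ℓ_s a)` of its linearisation `Σ_r L^{−d} • A(Γ_{c,x−s+r} ∪ −Γ_c)` (part 3's
`norm_mlog_hol_sub_asum_le` termwise; `s = 0` is part 3's `norm_Xavg_sub_Xhat_le`). [cite: Balaban1985Averaging, (42) p.23, p.25 (displays before (47))] -/
theorem norm_XavgOffset_sub_linear_le (L : ℕ) (hL : 1 ≤ L) (V : Site d → Fin d → 𝔸ˣ) (A : Site d → Fin d → 𝔸) (x : Site d) (κ : Fin d)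
    (s : Site d) {a : ℝ} (ha : 0 ≤ a)
    (hVA : ∀ (y : Site d) (μ : Fin d), l1 (y - x) ≤ 2 * (d * L + l1 s) + L + L → ((V y μ : 𝔸ˣ) : 𝔸) = exp (A y μ) ∧ ‖A y μ‖ ≤ a)
    (hsmall : Real.exp (((2 * (d * L + l1 s) + L + L : ℕ) : ℝ) * a) - 1 ≤ 1 / 2) :
    ‖(∑ r : Fin d → Fin L, (((L : ℝ) ^ d)⁻¹) • MatrixLog.mlog ((Wcx L V x κ (boxVec L r - s) : 𝔸ˣ) : 𝔸))
        - ∑ r : Fin d → Fin L, (((L : ℝ) ^ d)⁻¹) • asum A x (gammaWord L κ (boxVec L r - s) ++ seg κ (-(L : ℤ)))‖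
      ≤ expRem (2 * (Real.exp (((2 * (d * L + l1 s) + L + L : ℕ) : ℝ) * a) - 1))
          + expRem (((2 * (d * L + l1 s) + L + L : ℕ) : ℝ) * a) := by
  set ℓ : ℕ := 2 * (d * L + l1 s) + L + L with hℓ
  set B : ℝ := expRem (2 * (Real.exp ((ℓ : ℝ) * a) - 1)) + expRem ((ℓ : ℝ) * a) with hB
  have hL0 : (0 : ℝ) < (L : ℝ) ^ d := pow_pos (by exact_mod_cast (by omega : 0 < L)) _
  have hterm : ∀ r : Fin d → Fin L,
      ‖MatrixLog.mlog ((Wcx L V x κ (boxVec L r - s) : 𝔸ˣ) : 𝔸) - asum A x (gammaWord L κ (boxVec L r - s) ++ seg κ (-(L : ℤ)))‖ ≤ B := by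
    intro r
    set w := gammaWord L κ (boxVec L r - s) ++ seg κ (-(L : ℤ)) with hw
    have hlen : w.length ≤ ℓ := length_loop_offset_le L κ r s
    have hna : (w.length : ℝ) * a ≤ (ℓ : ℝ) * a := mul_le_mul_of_nonneg_right (by exact_mod_cast hlen) ha
    have hexp : Real.exp (w.length * a) - 1 ≤ Real.exp ((ℓ : ℝ) * a) - 1 := by linarith [Real.exp_le_exp.mpr hna]
    have h := norm_mlog_hol_sub_asum_le V A x ℓ ha hVA w x (by simp [l1]; exact hlen) (hexp.trans hsmall)
    rw [Wcx_eq_hol_loop]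
    refine h.trans (add_le_add (expRem_mono (by
        have := Real.one_le_exp (by positivity : (0 : ℝ) ≤ w.length * a); positivity) (by linarith))
      (expRem_mono (by positivity) hna))
  rw [← Finset.sum_sub_distrib]
  calc ‖∑ r : Fin d → Fin L, ((((L : ℝ) ^ d)⁻¹) • MatrixLog.mlog ((Wcx L V x κ (boxVec L r - s) : 𝔸ˣ) : 𝔸)
          - (((L : ℝ) ^ d)⁻¹) • asum A x (gammaWord L κ (boxVec L r - s) ++ seg κ (-(L : ℤ))))‖
      ≤ ∑ r : Fin d → Fin L, ‖(((L : ℝ) ^ d)⁻¹) • MatrixLog.mlog ((Wcx L V x κ (boxVec L r - s) : 𝔸ˣ) : 𝔸)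
          - (((L : ℝ) ^ d)⁻¹) • asum A x (gammaWord L κ (boxVec L r - s) ++ seg κ (-(L : ℤ)))‖ := norm_sum_le _ _
    _ ≤ ∑ _r : Fin d → Fin L, ((L : ℝ) ^ d)⁻¹ * B := Finset.sum_le_sum fun r _ => by
        rw [← smul_sub, norm_smul, norm_inv, Real.norm_of_nonneg hL0.le]
        exact mul_le_mul_of_nonneg_left (hterm r) (by positivity)
    _ = B := by
        rw [Finset.sum_const, Finset.card_univ, Fintype.card_fun, Fintype.card_fin, Fintype.card_fin, nsmul_eq_mul]
        push_cast
        field_simp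

omit [NormOneClass 𝔸] in
/-- **★★ THE NON-ABELIAN CORNER EXPONENT OF (42) MINUS THE OFFSET∕CENTRED ONE IS A COARSE PURE GAUGE UP TO SECOND ORDER AND `O(L³δ)`.**  At the coarse bond
`⟨x, x+Le_κ⟩`, `x = q₀ + L•ζ`: with the local exponential gauge of `norm_XavgOffset_sub_linear_le` (radius `ℓ_s ≥ ℓ`) and the unit-step `δ`-Lipschitz flux
of §3, `‖(X_c − X^{(s)}_c) − (Λ(ζ+e_κ) − Λ(ζ))‖ ≤ ρ₂(ℓ,a) + ρ₂(ℓ_s,a) + (2dL+|s|₁)·L·((2(dL+|s|₁)+L)δ) + |ζ|₁·2L²|s|₁δ`, where `X_c = Xavg L V x κ` is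
(42)'s exponent, `X^{(s)}_c` the displayed offset-stencil exponent, `Λ` the coarse tree potential of §2. [cite: Balaban1985Averaging, (42) p.23; Balaban1987RG1, p.252] -/
theorem norm_Xavg_sub_XavgOffset_sub_coarseAxial_le (L : ℕ) (hL : 1 ≤ L) (V : Site d → Fin d → 𝔸ˣ) (A : Site d → Fin d → 𝔸)
    (q₀ ζ : Site d) (κ : Fin d) (s : Site d) {a : ℝ} (ha : 0 ≤ a)
    (hVA : ∀ (y : Site d) (μ : Fin d), l1 (y - (q₀ + (L : ℤ) • ζ)) ≤ 2 * (d * L + l1 s) + L + L →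
      ((V y μ : 𝔸ˣ) : 𝔸) = exp (A y μ) ∧ ‖A y μ‖ ≤ a)
    (hsmall : Real.exp (((2 * (d * L + l1 s) + L + L : ℕ) : ℝ) * a) - 1 ≤ 1 / 2)
    {δ : ℝ} (hδ : 0 ≤ δ) {R : ℕ} (hR : L * (3 * l1 ζ + 2) ≤ R) (hR' : L * l1 ζ + (2 * (d * L + l1 s) + L) ≤ R)
    (hLip : ∀ (y : Site d) (m μ ν : Fin d), l1 (y - q₀) ≤ R → ‖asum A (y + e μ) (plaqWord m ν) - asum A y (plaqWord m ν)‖ ≤ δ) :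
    ‖(Xavg L V (q₀ + (L : ℤ) • ζ) κ
          - ∑ r : Fin d → Fin L, (((L : ℝ) ^ d)⁻¹) • MatrixLog.mlog ((Wcx L V (q₀ + (L : ℤ) • ζ) κ (boxVec L r - s) : 𝔸ˣ) : 𝔸))
        - (asum (fun z κ' => ∑ m : Fin d, ((L : ℝ) * (s m : ℝ)) • asum A (q₀ + (L : ℤ) • z) (plaqWord m κ')) 0 (treeWord (ζ + e κ))
            - asum (fun z κ' => ∑ m : Fin d, ((L : ℝ) * (s m : ℝ)) • asum A (q₀ + (L : ℤ) • z) (plaqWord m κ')) 0 (treeWord ζ))‖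
      ≤ (expRem (2 * (Real.exp (((2 * (d * L) + L + L : ℕ) : ℝ) * a) - 1)) + expRem (((2 * (d * L) + L + L : ℕ) : ℝ) * a))
        + (expRem (2 * (Real.exp (((2 * (d * L + l1 s) + L + L : ℕ) : ℝ) * a) - 1)) + expRem (((2 * (d * L + l1 s) + L + L : ℕ) : ℝ) * a))
        + ((2 * (d * L) + l1 s) * L * ((2 * (d * L + l1 s) + L) * δ) + l1 ζ * (2 * (L * δ) * ((L : ℝ) * l1 s))) := by
  set x : Site d := q₀ + (L : ℤ) • ζ with hx
  -- (42) vs its linearisation (part 3), the offset exponent vs its linearisation (§4), the linearised difference vs the coarse gauge (§3)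
  have h3 := Summit.QuantumFields.YangMills.BalabanUVNodes.N16Eq42PermutationDefectNonAbelian.norm_Xavg_sub_Xhat_le L hL V A x κ ha
    (fun y μ hy => hVA y μ (hy.trans (by omega))) (by
      refine le_trans ?_ hsmall
      have : (((2 * (d * L) + L + L : ℕ) : ℝ)) * a ≤ (((2 * (d * L + l1 s) + L + L : ℕ) : ℝ)) * a :=
        mul_le_mul_of_nonneg_right (by exact_mod_cast (by omega : 2 * (d * L) + L + L ≤ 2 * (d * L + l1 s) + L + L)) ha
      linarith [Real.exp_le_exp.mpr this])
  have h4 := norm_XavgOffset_sub_linear_le L hL V A x κ s ha hVA hsmall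
  have h5 := norm_corner_sub_stencil_sub_coarseAxial_le L hL A q₀ ζ κ s hδ hR hR' hLip
  -- abbreviations
  set X := Xavg L V x κ
  set Xh := Xhat L A x κ
  set Xs := ∑ r : Fin d → Fin L, (((L : ℝ) ^ d)⁻¹) • MatrixLog.mlog ((Wcx L V x κ (boxVec L r - s) : 𝔸ˣ) : 𝔸)
  set Xsh := ∑ r : Fin d → Fin L, (((L : ℝ) ^ d)⁻¹) • asum A x (gammaWord L κ (boxVec L r - s) ++ seg κ (-(L : ℤ)))
  set G := asum (fun z κ' => ∑ m : Fin d, ((L : ℝ) * (s m : ℝ)) • asum A (q₀ + (L : ℤ) • z) (plaqWord m κ')) 0 (treeWord (ζ + e κ))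
    - asum (fun z κ' => ∑ m : Fin d, ((L : ℝ) * (s m : ℝ)) • asum A (q₀ + (L : ℤ) • z) (plaqWord m κ')) 0 (treeWord ζ)
  calc ‖X - Xs - G‖ = ‖(X - Xh) + -(Xs - Xsh) + ((Xh - Xsh) - G)‖ := by congr 1; abel
    _ ≤ ‖X - Xh‖ + ‖-(Xs - Xsh)‖ + ‖(Xh - Xsh) - G‖ := norm_add₃_le
    _ = ‖X - Xh‖ + ‖Xs - Xsh‖ + ‖(Xh - Xsh) - G‖ := by rw [norm_neg]
    _ ≤ _ := add_le_add (add_le_add h3 h4) h5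

end NonAbelian

end

end Summit.QuantumFields.YangMills.BalabanUVNodes.N16Eq42FirstMomentGaugeCoarse
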